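import Summits.QuantumFields.GaugeBoot.DiagonalRPTorusUnitaryMoments
import HarnessLib

/-!
# Character convolution identities from quadratic moments; the case `G ≅ U(N)`
(gauge-boot, task L3(π), supplement 2/3)

HONEST FRAMING (cell `pub-gaugeboot`, page 1 of every file): the venture produces certified bounds
on lattice expectations at stated coupling, gauge group, dimension and torus size; NOT a mass gap,
NOT a continuum limit, NOT a string tension; NOT Yang–Mills-summit-bearing (barriers
`FixedCouplingUltralocality`, `PerturbativeInvisibility`). This module is compact-group
integration feeding the structural NEGATIVE results on torus diagonal RP for the unitary groups
`U(N)`; it discharges nothing else.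

## Content

A GENERIC layer: for a continuous `ρ : G →* M_N(ℂ)` with `ρ(g⁻¹) = ρ(g)^*` and the quadratic
moments `∫ ρ(g)_{ai} conj ρ(g)_{bk} dg = δ_{ab} δ_{ik}/N` (hypotheses, true for `G ≅ SU(N)` and
`G ≅ U(N)`):
* contraction rules `integral_sum_entry_mul_conj_entry_of_moments` (and the primed index pattern);
* `integral_trace_mul_inv_mul_trace_mul_of_moments` — `∫ χ(x g⁻¹) χ(g y) dg = χ(x y)/N`;
* `integral_trace_conj_mul_of_moments`, `integral_re_trace_conj_mul_of_moments` —
  `∫ χ(g x g⁻¹ y) dg = χ(x) χ(y)/N` and its real part (R2 with `c₂ = 1/N`);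
* if moreover `∫ ρ_{ab} ρ_{ij} = 0`: `integral_re_trace_mul_inv_mul_of_moments` — (R1) with
  `c₁ = 1/(2N)`.
The case `G ≅ U(N)` (`IsUnitaryModel ρ`, `N ≥ 1`; moments from `DiagonalRPTorusUnitaryMoments`):
**`integral_re_trace_mul_inv_mul_unitary`** (R1, `c₁ = 1/(2N)`) and
**`integral_re_trace_conj_mul_unitary`** (R2, `c₂ = 1/N`).

Folklore (Schur orthogonality; M. Creutz, *Quarks, gluons and lattices* (1983) §8); everything is
proved, no definition, no named fact.
-/

noncomputable section

open MeasureTheory Complex Finset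
open Literature.MathematicalPhysics.QuantumFieldTheory
open Summit.Ventures.YMGap.RobustBall.HaarSecondMoments

namespace Summit.QuantumFields.GaugeBoot

namespace DiagRPSUN

variable {N : ℕ} {G : Type*} [Group G] [TopologicalSpace G] [IsTopologicalGroup G] [CompactSpace G]
  [MeasurableSpace G] [BorelSpace G] (ρ : G →* Matrix (Fin N) (Fin N) ℂ)

/-! ## Contraction rules from the quadratic moments -/

section Generic

/-- **Contraction rule** from the quadratic moments: for every coefficient tensor `c`,
`∫ Σ_{pqrs} c_{pqrs} ρ(g)_{pq} conj ρ(g)_{rs} dg = N⁻¹ Σ_{pq} c_{pqpq}`. -/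
theorem integral_sum_entry_mul_conj_entry_of_moments (hcont : Continuous ρ)
    (hmom : ∀ a i b k : Fin N, ∫ g, ρ g a i * (starRingEnd ℂ) (ρ g b k) ∂haarProbability G =
      if a = b ∧ i = k then (N : ℂ)⁻¹ else 0)
    (c : Fin N → Fin N → Fin N → Fin N → ℂ) :
    ∫ g, ∑ p, ∑ q, ∑ r, ∑ s, c p q r s * (ρ g p q * (starRingEnd ℂ) (ρ g r s))
        ∂haarProbability G = (N : ℂ)⁻¹ * ∑ p, ∑ q, c p q p q := by
  have hI : ∀ p q r s, Integrable (fun g => c p q r s * (ρ g p q * (starRingEnd ℂ) (ρ g r s)))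
      (haarProbability G) := fun p q r s =>
    (integrable_entry_mul_conj_entry ρ hcont p q r s).const_mul _
  have step : ∀ p q, ∫ g, ∑ r, ∑ s, c p q r s * (ρ g p q * (starRingEnd ℂ) (ρ g r s))
      ∂haarProbability G = (N : ℂ)⁻¹ * c p q p q := by
    intro p q
    rw [integral_finsetSum _ fun r _ => integrable_finsetSum _ fun s _ => hI p q r s]
    simp_rw [integral_finsetSum _ fun s _ => hI p q _ s, integral_const_mul, hmom]
    have hr : ∀ r ∈ (univ : Finset (Fin N)), r ≠ p →
        ∑ s, c p q r s * (if p = r ∧ q = s then ((N : ℂ))⁻¹ else 0) = 0 := by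
      intro r _ hr
      exact Finset.sum_eq_zero fun s _ => by rw [if_neg (fun h => hr h.1.symm), mul_zero]
    rw [Finset.sum_eq_single_of_mem p (mem_univ p) hr]
    have hs : ∀ s ∈ (univ : Finset (Fin N)), s ≠ q →
        c p q p s * (if p = p ∧ q = s then ((N : ℂ))⁻¹ else 0) = 0 := by
      intro s _ hs
      rw [if_neg (fun h => hs h.2.symm), mul_zero]
    rw [Finset.sum_eq_single_of_mem q (mem_univ q) hs, if_pos ⟨rfl, rfl⟩, mul_comm]
  rw [integral_finsetSum _ fun p _ => integrable_finsetSum _ fun q _ =>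
    integrable_finsetSum _ fun r _ => integrable_finsetSum _ fun s _ => hI p q r s]
  simp_rw [integral_finsetSum _ fun q _ => integrable_finsetSum _ fun r _ =>
    integrable_finsetSum _ fun s _ => hI _ q r s, step, ← Finset.mul_sum]

/-- **Contraction rule, second index pattern**:
`∫ Σ_{pqrs} c_{pqrs} ρ(g)_{ps} conj ρ(g)_{qr} dg = N⁻¹ Σ_{ps} c_{ppss}`. -/
theorem integral_sum_entry_mul_conj_entry'_of_moments (hcont : Continuous ρ)
    (hmom : ∀ a i b k : Fin N, ∫ g, ρ g a i * (starRingEnd ℂ) (ρ g b k) ∂haarProbability G =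
      if a = b ∧ i = k then (N : ℂ)⁻¹ else 0)
    (c : Fin N → Fin N → Fin N → Fin N → ℂ) :
    ∫ g, ∑ p, ∑ q, ∑ r, ∑ s, c p q r s * (ρ g p s * (starRingEnd ℂ) (ρ g q r))
        ∂haarProbability G = (N : ℂ)⁻¹ * ∑ p, ∑ s, c p p s s := by
  have hI : ∀ p q r s, Integrable (fun g => c p q r s * (ρ g p s * (starRingEnd ℂ) (ρ g q r)))
      (haarProbability G) := fun p q r s =>
    (integrable_entry_mul_conj_entry ρ hcont p s q r).const_mul _
  have step : ∀ p, ∫ g, ∑ q, ∑ r, ∑ s, c p q r s * (ρ g p s * (starRingEnd ℂ) (ρ g q r))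
      ∂haarProbability G = (N : ℂ)⁻¹ * ∑ s, c p p s s := by
    intro p
    rw [integral_finsetSum _ fun q _ => integrable_finsetSum _ fun r _ =>
      integrable_finsetSum _ fun s _ => hI p q r s]
    simp_rw [integral_finsetSum _ fun r _ => integrable_finsetSum _ fun s _ => hI p _ r s,
      integral_finsetSum _ fun s _ => hI p _ _ s, integral_const_mul, hmom]
    have hq : ∀ q ∈ (univ : Finset (Fin N)), q ≠ p →
        ∑ r, ∑ s, c p q r s * (if p = q ∧ s = r then ((N : ℂ))⁻¹ else 0) = 0 := by
      intro q _ hq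
      exact Finset.sum_eq_zero fun r _ => Finset.sum_eq_zero fun s _ => by
        rw [if_neg (fun h => hq h.1.symm), mul_zero]
    rw [Finset.sum_eq_single_of_mem p (mem_univ p) hq, Finset.mul_sum]
    refine Finset.sum_comm.trans (Finset.sum_congr rfl fun s _ => ?_)
    have hr : ∀ r ∈ (univ : Finset (Fin N)), r ≠ s →
        c p p r s * (if p = p ∧ s = r then ((N : ℂ))⁻¹ else 0) = 0 := by
      intro r _ hr
      rw [if_neg (fun h => hr h.2.symm), mul_zero]
    rw [Finset.sum_eq_single_of_mem s (mem_univ s) hr, if_pos ⟨rfl, rfl⟩, mul_comm]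
  rw [integral_finsetSum _ fun p _ => integrable_finsetSum _ fun q _ =>
    integrable_finsetSum _ fun r _ => integrable_finsetSum _ fun s _ => hI p q r s]
  simp_rw [step, ← Finset.mul_sum]

/-- **Convolution identity** `∫ χ(x g⁻¹) χ(g y) dg = χ(x y)/N` from the moments. -/
theorem integral_trace_mul_inv_mul_trace_mul_of_moments (hcont : Continuous ρ)
    (hunit : ∀ g : G, ρ g⁻¹ = star (ρ g))
    (hmom : ∀ a i b k : Fin N, ∫ g, ρ g a i * (starRingEnd ℂ) (ρ g b k) ∂haarProbability G =
      if a = b ∧ i = k then (N : ℂ)⁻¹ else 0) (x y : G) :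
    ∫ g, (ρ (x * g⁻¹)).trace * (ρ (g * y)).trace ∂haarProbability G =
      (N : ℂ)⁻¹ * (ρ (x * y)).trace := by
  simp_rw [map_mul, hunit, trace_mul_star_mul_trace_mul,
    integral_sum_entry_mul_conj_entry_of_moments ρ hcont hmom]
  congr 1

/-- **Class identity** `∫ χ(g x g⁻¹ y) dg = χ(x) χ(y)/N` from the moments. -/
theorem integral_trace_conj_mul_of_moments (hcont : Continuous ρ) (hunit : ∀ g : G, ρ g⁻¹ = star (ρ g))
    (hmom : ∀ a i b k : Fin N, ∫ g, ρ g a i * (starRingEnd ℂ) (ρ g b k) ∂haarProbability G =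
      if a = b ∧ i = k then (N : ℂ)⁻¹ else 0) (x y : G) :
    ∫ g, (ρ (g * x * g⁻¹ * y)).trace ∂haarProbability G =
      (N : ℂ)⁻¹ * ((ρ x).trace * (ρ y).trace) := by
  simp_rw [map_mul, hunit, trace_mul_mul_star_mul,
    integral_sum_entry_mul_conj_entry'_of_moments ρ hcont hmom]
  congr 1
  simp only [Matrix.trace, Matrix.diag_apply, Finset.sum_mul, Finset.mul_sum]

/-- **Real class identity** `∫ Re χ(g x g⁻¹ y) dg = Re(χ(x) χ(y))/N` from the moments
((R2) with `c₂ = 1/N`). -/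
theorem integral_re_trace_conj_mul_of_moments (hcont : Continuous ρ)
    (hunit : ∀ g : G, ρ g⁻¹ = star (ρ g))
    (hmom : ∀ a i b k : Fin N, ∫ g, ρ g a i * (starRingEnd ℂ) (ρ g b k) ∂haarProbability G =
      if a = b ∧ i = k then (N : ℂ)⁻¹ else 0) (x y : G) :
    ∫ g, ((ρ (g * x * g⁻¹ * y)).trace).re ∂haarProbability G =
      (N : ℝ)⁻¹ * ((ρ x).trace * (ρ y).trace).re := by
  have hc : Continuous fun g : G => (ρ (g * x * g⁻¹ * y)).trace :=
    hcont.matrix_trace.comp (((continuous_id.mul continuous_const).mul continuous_inv).mul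
      continuous_const)
  have h := integral_trace_conj_mul_of_moments ρ hcont hunit hmom x y
  have hre := integral_re (𝕜 := ℂ) (integrable_of_continuous hc)
  simp only [RCLike.re_to_complex] at hre
  rw [hre, h, Complex.mul_re, Complex.inv_re, Complex.inv_im, Complex.natCast_re,
    Complex.natCast_im, Complex.normSq_natCast]
  by_cases hN : (N : ℝ) = 0
  · simp [hN]
  · field_simp
    ring

/-- The "unconjugated" pairing vanishes when `∫ ρ_{ab} ρ_{ij} = 0`:
`∫ χ(x g⁻¹) conj χ(g y) dg = 0`. -/
theorem integral_trace_mul_inv_mul_conj_trace_mul_of_moments (hcont : Continuous ρ)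
    (hunit : ∀ g : G, ρ g⁻¹ = star (ρ g))
    (hmom0 : ∀ a b i j : Fin N, ∫ g, ρ g a b * ρ g i j ∂haarProbability G = 0) (x y : G) :
    ∫ g, (ρ (x * g⁻¹)).trace * (starRingEnd ℂ) (ρ (g * y)).trace ∂haarProbability G = 0 := by
  have hexp : ∀ g : G, (ρ (x * g⁻¹)).trace * (starRingEnd ℂ) (ρ (g * y)).trace =
      ∑ p, ∑ q, ∑ r, ∑ s, (ρ x r s * (starRingEnd ℂ) (ρ y q p)) *
        (starRingEnd ℂ) (ρ g p q * ρ g r s) := by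
    intro g
    rw [map_mul, map_mul, hunit]
    simp only [Matrix.trace, Matrix.diag_apply, Matrix.mul_apply, Matrix.star_apply,
      Complex.star_def, map_sum, map_mul, Finset.sum_mul, Finset.mul_sum]
    exact Finset.sum_congr rfl fun p _ => Finset.sum_congr rfl fun q _ =>
      Finset.sum_congr rfl fun r _ => Finset.sum_congr rfl fun s _ => by ring
  have hI : ∀ p q r s, Integrable (fun g => (ρ x r s * (starRingEnd ℂ) (ρ y q p)) *
      (starRingEnd ℂ) (ρ g p q * ρ g r s)) (haarProbability G) := fun p q r s =>
    (integrable_of_continuous (Complex.continuous_conj.comp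
      ((hcont.matrix_elem p q).mul (hcont.matrix_elem r s)))).const_mul _
  simp_rw [hexp]
  rw [integral_finsetSum _ fun p _ => integrable_finsetSum _ fun q _ =>
    integrable_finsetSum _ fun r _ => integrable_finsetSum _ fun s _ => hI p q r s]
  refine Finset.sum_eq_zero fun p _ => ?_
  rw [integral_finsetSum _ fun q _ => integrable_finsetSum _ fun r _ =>
    integrable_finsetSum _ fun s _ => hI p q r s]
  refine Finset.sum_eq_zero fun q _ => ?_
  rw [integral_finsetSum _ fun r _ => integrable_finsetSum _ fun s _ => hI p q r s]
  refine Finset.sum_eq_zero fun r _ => ?_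
  rw [integral_finsetSum _ fun s _ => hI p q r s]
  refine Finset.sum_eq_zero fun s _ => ?_
  rw [integral_const_mul, integral_conj, hmom0, map_zero, mul_zero]

/-- **Real convolution identity** from the moments ((R1) with `c₁ = 1/(2N)`):
`∫ Re χ(x g⁻¹) Re χ(g y) dg = Re χ(x y)/(2N)` when also `∫ ρ_{ab} ρ_{ij} = 0`. -/
theorem integral_re_trace_mul_inv_mul_of_moments (hcont : Continuous ρ)
    (hunit : ∀ g : G, ρ g⁻¹ = star (ρ g))
    (hmom : ∀ a i b k : Fin N, ∫ g, ρ g a i * (starRingEnd ℂ) (ρ g b k) ∂haarProbability G =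
      if a = b ∧ i = k then (N : ℂ)⁻¹ else 0)
    (hmom0 : ∀ a b i j : Fin N, ∫ g, ρ g a b * ρ g i j ∂haarProbability G = 0) (x y : G) :
    ∫ g, ((ρ (x * g⁻¹)).trace).re * ((ρ (g * y)).trace).re ∂haarProbability G =
      (2 * N : ℝ)⁻¹ * ((ρ (x * y)).trace).re := by
  have hpt : ∀ g : G, ((ρ (x * g⁻¹)).trace).re * ((ρ (g * y)).trace).re =
      (((ρ (x * g⁻¹)).trace * (ρ (g * y)).trace).re +
        ((ρ (x * g⁻¹)).trace * (starRingEnd ℂ) (ρ (g * y)).trace).re) / 2 := fun g => by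
    simp only [Complex.mul_re, Complex.conj_re, Complex.conj_im]
    ring
  have hc1 : Continuous fun g : G => (ρ (x * g⁻¹)).trace * (ρ (g * y)).trace :=
    (hcont.matrix_trace.comp (continuous_const.mul continuous_inv)).mul
      (hcont.matrix_trace.comp (continuous_id.mul continuous_const))
  have hc2 : Continuous fun g : G => (ρ (x * g⁻¹)).trace * (starRingEnd ℂ) (ρ (g * y)).trace :=
    (hcont.matrix_trace.comp (continuous_const.mul continuous_inv)).mul
      (Complex.continuous_conj.comp (hcont.matrix_trace.comp (continuous_id.mul continuous_const)))
  have hre1 := integral_re (𝕜 := ℂ) (integrable_of_continuous hc1)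
  have hre2 := integral_re (𝕜 := ℂ) (integrable_of_continuous hc2)
  simp only [RCLike.re_to_complex] at hre1 hre2
  have hi1 : Integrable (fun g : G => ((ρ (x * g⁻¹)).trace * (ρ (g * y)).trace).re)
      (haarProbability G) := integrable_of_continuous (Complex.continuous_re.comp hc1)
  have hi2 : Integrable
      (fun g : G => ((ρ (x * g⁻¹)).trace * (starRingEnd ℂ) (ρ (g * y)).trace).re)
      (haarProbability G) := integrable_of_continuous (Complex.continuous_re.comp hc2)
  simp_rw [hpt]
  rw [integral_div, integral_add hi1 hi2, hre1, hre2,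
    integral_trace_mul_inv_mul_trace_mul_of_moments ρ hcont hunit hmom,
    integral_trace_mul_inv_mul_conj_trace_mul_of_moments ρ hcont hunit hmom0, Complex.zero_re,
    add_zero, Complex.mul_re, Complex.inv_re, Complex.inv_im, Complex.natCast_re,
    Complex.natCast_im, Complex.normSq_natCast]
  by_cases hN : (N : ℝ) = 0
  · simp [hN]
  · field_simp
    ring

end Generic

/-! ## The case `G ≅ U(N)` -/

section Unitary

/-- ★ **(R1) for `G ≅ U(N)`**: `∫ Re χ(x g⁻¹) Re χ(g y) dg = Re χ(x y)/(2N)` (every `N`). -/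
theorem integral_re_trace_mul_inv_mul_unitary (hρ : IsUnitaryModel ρ) (x y : G) :
    ∫ g, ((ρ (x * g⁻¹)).trace).re * ((ρ (g * y)).trace).re ∂haarProbability G =
      (2 * N : ℝ)⁻¹ * ((ρ (x * y)).trace).re :=
  integral_re_trace_mul_inv_mul_of_moments ρ hρ.1 (map_inv_eq_star_unitary ρ hρ)
    (integral_entry_mul_conj_entry_unitary ρ hρ) (integral_entry_mul_entry_eq_zero_unitary ρ hρ) x y

/-- ★ **(R2) for `G ≅ U(N)`**: `∫ Re χ(g x g⁻¹ y) dg = Re(χ(x) χ(y))/N`. -/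
theorem integral_re_trace_conj_mul_unitary (hρ : IsUnitaryModel ρ) (x y : G) :
    ∫ g, ((ρ (g * x * g⁻¹ * y)).trace).re ∂haarProbability G =
      (N : ℝ)⁻¹ * ((ρ x).trace * (ρ y).trace).re :=
  integral_re_trace_conj_mul_of_moments ρ hρ.1 (map_inv_eq_star_unitary ρ hρ)
    (integral_entry_mul_conj_entry_unitary ρ hρ) x y

end Unitary

end DiagRPSUN

end Summit.QuantumFields.GaugeBoot
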